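import Summits.HodgeConjecture.HodgeConjecture.Theorems.F0P3cStCharTSTubeOrbitEq          -- ★ p851886 (LH1-p03 g9) ORBIT-TUBE-EQ `setOf_conj_eq_smul_sandwich`; brings ★ (J5c) p851835, ★ (J4c) p851809, ★ (J4a)
import Summits.HodgeConjecture.HodgeConjecture.Theorems.F0P3cStCharTSSandwichMeasure     -- ★ (J4b) (LH4-p02 g8): `measure_sandwich_eq_vanDijk_mul_measure_level`, `map_conj_weylLongU_level_eq`; brings ★ LevelBoxSubgroups ∕ LevelBoxes ∕ L5
import Summits.HodgeConjecture.HodgeConjecture.Theorems.F0P3cStCharTSLevelSchedule      -- ★ (J5-ARITH) p851821 (LH4-p02 g8): `exists_levelSchedule_basis`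
import HarnessLib

/-!
# F0 · P3c · line LH6 «StCharTS» — ROAD «JAC-LOC» brick (J6-M) «MODEL LEVEL PACKAGE»: for a regular split-torus element `s` of `U(σ, Φ₃)(K)` and every level `γ`
# small against the root-unit sizes of `s`, ONE subgroup `P̃` with `Ad(K_γ)(s·T_γ) = s·P̃` and `ν(P̃) = c(s)·c(s_w)·ν(K_γ)` (Harish-Chandra 1970 L. 22; van Dijk 1972 §2)

Cell `pub/hodgecm-mathlib`, crux H413 = `stmt-HodgeConjecture-24833` (lane `--supports … --as helper`); seat LH6-p03 (g5), holder of the road «JAC-LOC» (split of (J6) ED. 2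
announced F0∕P3b 2026-09-02).  THEOREMS ONLY; no definition ∕ instance ∕ notation ∕ named fact ∕ `sorry`.  HONEST LABEL: count-neutral; closes no organ.  HC_CM is proved
only modulo the 7 printed citations (2 remaining: hLiu418 = `stmt-HodgeConjecture-24832`, h413 = `stmt-HodgeConjecture-24833`) until rung 0 closes.

WHAT.  The orbit identity ★ «ORBIT-TUBE-EQ» `setOf_conj_eq_smul_sandwich` (LH1-p03; = ★ (J4c) p851809 ⊆ + ★ (J5c) p851835 ⊇) and the mass identity ★ (J4b)
`measure_sandwich_eq_vanDijk_mul_measure_level` carry some forty binders (auxiliary levels `γ′, ε`, box subgroups `B, B̄`, a level schedule, (L1) reverse, the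
abelian-sandwich frame).  This file DISCHARGES them all from finitely many inequalities «`γ` small against the sizes `A = |a−1|, B = |b−1|, A′ = |a_w−1|, B′ = |b_w−1|`
and bounds `C ≥ |a − σa|`, `C′ ≥ |a_w − σa_w|`» (§2 `orbit_and_mass_of_small_level`: `γ′ := Rγ`, `ε := ργ` with `ρ ≤ sizes ≤ R`, `ρ ≤ 1 ≤ R`; boxes by ★ (J2)
`exists_subgroup_coe_eq_image_box`; schedule + basis by ★ (J5-ARITH); `hab` by ★ (L5); (L1) reverse = §1 `mem_level_of_box`, valid for every `η` with `v(½)η ≤ 1`),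
and §3 `exists_small_level_bound` produces such a `γ₀` from the sizes ALONE (pure value-group arithmetic) — so on a neighbourhood of `t₀` where the sizes are
constant (★ SHIFT-LC ∕ (J6-D)) one `γ₀` serves every `s`, which is what (J6) ED. 2's `horbit` clause needs (`n₀` with `γₙ ≤ γ₀`).

## References
* [HarishChandra1970] Harish-Chandra, *Harmonic analysis on reductive p-adic groups*, LNM 162 (1970), L. 22. [vanDijk1972] G. van Dijk, Math. Ann. 199 (1972), §2.
* [Casselman1995] W. Casselman, *Introduction to the theory of admissible representations…* (1995), §1.4 Prop. 1.4.4. [Rogawski1990] Ann. of Math. Stud. 123, §12.5 p. 182.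
-/

set_option autoImplicit false
-- the mandated namespace has the single-problem summit's repeated segment (`HodgeConjecture.HodgeConjecture`)
set_option linter.dupNamespace false

noncomputable section

open Matrix ValuativeRel MeasureTheory Filter Topology Set
open scoped MatrixGroups NNReal ENNReal Pointwise
open Literature.NumberTheory.Automorphic Literature.NumberTheory.Automorphic.UnitaryGroup Literature.NumberTheory.Automorphic.UnitaryGroup.HeisRing
open Literature.NumberTheory.Rogawski1990
open Summit.HodgeConjecture.HodgeConjecture.Cruxes.H413.F0P3cStCharTSTorusUnipotentConj
open Summit.HodgeConjecture.HodgeConjecture.Cruxes.H413.F0P3cStCharTSVanDijkBox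
open Summit.HodgeConjecture.HodgeConjecture.Cruxes.H413.F0P3cStCharTSLevelBoxes
open Summit.HodgeConjecture.HodgeConjecture.Cruxes.H413.F0P3cStCharTSLevelBoxSubgroups
open Summit.HodgeConjecture.HodgeConjecture.Cruxes.H413.F0P3cStCharTSAbelianSandwich
open Summit.HodgeConjecture.HodgeConjecture.Cruxes.H413.F0P3cStCharTSSandwichMeasure
open Summit.HodgeConjecture.HodgeConjecture.Cruxes.H413.F0P3cStCharTSLevelSchedule


open Summit.HodgeConjecture.HodgeConjecture.Cruxes.H413.F0P3cStCharTSTubeOrbitEq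

namespace Summit.HodgeConjecture.HodgeConjecture.Cruxes.H413.F0P3cStCharTSLevelPackage

/-! ## §1 (L1) reverse for every `η` with `v(½)·η ≤ 1` -/

section L1

variable {K : Type*} [Field K] [ValuativeRel K] (σ : K →+* K) (hσ : ∀ x, σ (σ x) = x) [Invertible (2 : K)]
  {J : Matrix (Fin 3) (Fin 3) K} (hJ : J = (StdForm.antidiagonal 3).over K)
  (hσv : ∀ x, valuation K (σ x) = valuation K x)

omit [Invertible (2 : K)] in
/-- `v(2) ≤ 1` (ultrametric inequality on `1 + 1`). [cite: Casselman1995, §1.4 Prop. 1.4.4] -/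
theorem valuation_two_le_one : valuation K (2 : K) ≤ 1 := by
  have h : (2 : K) = 1 + 1 := by norm_num
  rw [h]
  exact (Valuation.map_add _ _ _).trans (by rw [Valuation.map_one, max_self])

/-- `v(½)·η ≤ 1` forces `η ≤ 1` (`v(2) ≤ 1`). [cite: Casselman1995, §1.4 Prop. 1.4.4] -/
theorem le_one_of_valuation_invOf_two_mul_le {η : ValueGroupWithZero K} (h2 : valuation K (⅟(2 : K)) * η ≤ 1) : η ≤ 1 := by
  have h1 : valuation K (2 : K) * valuation K (⅟(2 : K)) = 1 := by
    rw [← Valuation.map_mul, mul_invOf_self, Valuation.map_one]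
  calc η = valuation K (2 : K) * (valuation K (⅟(2 : K)) * η) := by rw [← mul_assoc, h1, one_mul]
    _ ≤ 1 * 1 := mul_le_mul' valuation_two_le_one h2
    _ = 1 := one_mul 1

include hσv in
/-- **(L1) REVERSE for every admissible level**: `v(½)η ≤ 1`, `n ∈ N`, `v(x n) ≤ η`, `v(y n) ≤ η` ⇒ `n ∈ K_η` — the binder `hL1rev` of ★ (J5c) ∕ ★ ORBIT-TUBE-EQ (★ (L1)
`mem_level_iff_of_mem_unipotentU` asks `η < 1`; its reverse direction only uses `η ≤ 1`, which `v(½)η ≤ 1` forces). [cite: Casselman1995, §1.4 Prop. 1.4.4] -/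
theorem mem_level_of_box {η : ValueGroupWithZero K} (h2 : valuation K (⅟(2 : K)) * η ≤ 1) (n : ↥(unipotentU σ J))
    (hx : valuation K (heisX σ n) ≤ η) (hy : valuation K (heisY σ hσ hJ n : K) ≤ η) :
    (n : ↥(unitaryGroupOfForm σ J)) ∈ (congruenceGL 3 η).comap (unitaryGroupOfForm σ J).subtype := by
  have hη1 : η ≤ 1 := le_one_of_valuation_invOf_two_mul_le h2
  rw [Subgroup.mem_comap, Subgroup.coe_subtype, mem_congruenceGL_iff]
  have hM := coe_coe_eq_heisMatrix σ hσ hJ n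
  have hMi : ((((n : ↥(unitaryGroupOfForm σ J)) : GL (Fin 3) K)⁻¹ : GL (Fin 3) K) : Matrix (Fin 3) (Fin 3) K) =
      heisMatrix σ (heisX σ n⁻¹) (heisY σ hσ hJ n⁻¹ : K) := by
    rw [← coe_coe_eq_heisMatrix σ hσ hJ n⁻¹]; rfl
  have hz := valuation_heisZ_le σ hσv h2 hx hy
  have hx' : valuation K (heisX σ n⁻¹) ≤ η := by rw [heisX_inv, Valuation.map_neg]; exact hx
  have hy' : valuation K (heisY σ hσ hJ n⁻¹ : K) ≤ η := by rw [coe_heisY_inv, Valuation.map_neg]; exact hy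
  have hz' := valuation_heisZ_le σ hσv h2 hx' hy'
  refine ⟨⟨?_, ?_⟩, ?_, ?_⟩
  · rw [hM]; exact valBound_one_heisMatrix σ hσv (hx.trans hη1) (hz.trans hη1)
  · rw [hMi]; exact valBound_one_heisMatrix σ hσv (hx'.trans hη1) (hz'.trans hη1)
  · rw [hM]; exact valBound_heisMatrix_sub_one σ hσv hx hz
  · rw [hMi]; exact valBound_heisMatrix_sub_one σ hσv hx' hz'

end L1

/-! ## §2 The package at a small level -/

section Package

variable {K : Type*} [Field K] [ValuativeRel K] [TopologicalSpace K] [IsNonarchimedeanLocalField K]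
  [IsTopologicalRing K] [T2Space K] [SecondCountableTopology K] [MeasurableSpace K] [BorelSpace K]
  (σ : K →+* K) (hσ : ∀ x, σ (σ x) = x) (hσc : Continuous σ) [Invertible (2 : K)]
  {J : Matrix (Fin 3) (Fin 3) K} (hJ : J = (StdForm.antidiagonal 3).over K)
  (hσv : ∀ x, valuation K (σ x) = valuation K x)
  [MeasurableSpace ↥(unitaryGroupOfForm σ J)] [BorelSpace ↥(unitaryGroupOfForm σ J)]
  [MeasurableSpace ↥(unipotentU σ J)] [BorelSpace ↥(unipotentU σ J)]

include hσ hσc hJ hσv in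
/-- **(J6-M) THE MODEL LEVEL PACKAGE.**  `s = diag(d)` regular with reversed writing `s_w = diag(d ∘ rev)`; sizes `A = |a−1|`, `B = |b−1|` (`a = d₀⁻¹d₁`, `b = d₀⁻¹d₂`),
`A′ = |a_w−1|`, `B′ = |b_w−1|` (`a_w = d₂⁻¹d₁`, `b_w = d₂⁻¹d₀`), bounds `C ≥ |a − σa|`, `C′ ≥ |a_w − σa_w|`, `ρ ≤ A, B, A′, B′, 1 ≤ R`-window; a level `γ ≠ 0` with
`γ < ρ`, `Rγ < 1`, `v(½)Rγ ≤ 1`, `R²γ ≤ ρ`, `v(½)Cγ ≤ B`, `v(½)C′γ ≤ B′`, `v(½)Cργ ≤ A²`, `v(½)C′ργ ≤ A′²`, `v(½)A²γ ≤ B`, `v(½)A′²γ ≤ B′`.  THEN there is a subgroup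
`P̃` (the level-`γ` sandwich `B̄ ⊔ ((K_γ ⊓ T) ⊔ (B ⊔ K_{ργ}))`), OPEN, with **`{k s τ k⁻¹ | k ∈ K_γ, τ ∈ K_γ ∩ T} = s · P̃`** and **`ν(P̃) = c(s)·c(s_w)·ν(K_γ)`** for every
left-invariant Borel `ν` (`c(·)` = ★ (L7) `measure_vanDijk_box`'s constant, as in ★ (J4b)). [cite: HarishChandra1970, Lemma 22] [cite: vanDijk1972, §2]
[cite: Casselman1995, §1.4 Prop. 1.4.4] [cite: Rogawski1990, §12.5 p. 182] -/
theorem orbit_and_mass_of_small_level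
    (μN : Measure ↥(unipotentU σ J)) [μN.IsHaarMeasure]
    (s sw : ↥(torusU σ J)) {d : Fin 3 → Kˣ}
    (hd : glDiagonal 3 K d = ((s : ↥(unitaryGroupOfForm σ J)) : GL (Fin 3) K))
    (hdw : glDiagonal 3 K (d ∘ Fin.rev) = ((sw : ↥(unitaryGroupOfForm σ J)) : GL (Fin 3) K))
    (hreg : IsRegularElt ((s : ↥(unitaryGroupOfForm σ J)) : GL (Fin 3) K))
    (hregw : IsRegularElt ((sw : ↥(unitaryGroupOfForm σ J)) : GL (Fin 3) K))
    {A B A' B' C C' ρ R γ : ValueGroupWithZero K}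
    (hA : valuation K ((((d 0)⁻¹ * d 1 : Kˣ) : K) - 1) = A) (hB : valuation K ((((d 0)⁻¹ * d 2 : Kˣ) : K) - 1) = B)
    (hA' : valuation K ((((d 2)⁻¹ * d 1 : Kˣ) : K) - 1) = A') (hB' : valuation K ((((d 2)⁻¹ * d 0 : Kˣ) : K) - 1) = B')
    (hC : valuation K ((((d 0)⁻¹ * d 1 : Kˣ) : K) - σ (((d 0)⁻¹ * d 1 : Kˣ) : K)) ≤ C)
    (hC' : valuation K ((((d 2)⁻¹ * d 1 : Kˣ) : K) - σ (((d 2)⁻¹ * d 1 : Kˣ) : K)) ≤ C')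
    (hρA : ρ ≤ A) (hρB : ρ ≤ B) (hρA' : ρ ≤ A') (hρB' : ρ ≤ B') (hρ1 : ρ ≤ 1)
    (hRA : A ≤ R) (hRB : B ≤ R) (hRA' : A' ≤ R) (hRB' : B' ≤ R) (hR1 : 1 ≤ R)
    (hγ0 : γ ≠ 0) (hγρ : γ < ρ) (hRγ : R * γ < 1) (h2R : valuation K (⅟(2 : K)) * (R * γ) ≤ 1) (hRR : R * R * γ ≤ ρ)
    (hdepth : valuation K (⅟(2 : K)) * C * γ ≤ B) (hdepth' : valuation K (⅟(2 : K)) * C' * γ ≤ B')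
    (hCA : valuation K (⅟(2 : K)) * C * (ρ * γ) ≤ A * A) (hCA' : valuation K (⅟(2 : K)) * C' * (ρ * γ) ≤ A' * A')
    (hbox : valuation K (⅟(2 : K)) * (A * A) * γ ≤ B) (hbox' : valuation K (⅟(2 : K)) * (A' * A') * γ ≤ B') :
    ∃ P : Subgroup ↥(unitaryGroupOfForm σ J), IsOpen (P : Set ↥(unitaryGroupOfForm σ J)) ∧
      {x : ↥(unitaryGroupOfForm σ J) |
          ∃ k ∈ (((congruenceGL 3 γ).comap (unitaryGroupOfForm σ J).subtype : Subgroup ↥(unitaryGroupOfForm σ J)) : Set ↥(unitaryGroupOfForm σ J)),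
          ∃ τ ∈ (((congruenceGL 3 γ).comap (unitaryGroupOfForm σ J).subtype : Subgroup ↥(unitaryGroupOfForm σ J)) : Set ↥(unitaryGroupOfForm σ J)),
            τ ∈ torusU σ J ∧ k * s * τ * k⁻¹ = x} = (s : ↥(unitaryGroupOfForm σ J)) • (P : Set ↥(unitaryGroupOfForm σ J)) ∧
      ∀ (ν : Measure ↥(unitaryGroupOfForm σ J)), ν.IsMulLeftInvariant →
        ν (P : Set ↥(unitaryGroupOfForm σ J)) =
          ((distribHaarChar K (isUnit_rootA_sub_one σ s hd hreg).unit *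
              skewModulus σ hσc (isUnit_rootB_sub_one σ s hd hreg).unit
                (map_unit_torusCentralScalar_sub_one σ hJ s hd (isUnit_rootB_sub_one σ s hd hreg)) : ℝ≥0) : ℝ≥0∞) *
          ((distribHaarChar K (isUnit_rootA_sub_one σ sw hdw hregw).unit *
              skewModulus σ hσc (isUnit_rootB_sub_one σ sw hdw hregw).unit
                (map_unit_torusCentralScalar_sub_one σ hJ sw hdw (isUnit_rootB_sub_one σ sw hdw hregw)) : ℝ≥0) : ℝ≥0∞) *
          ν (((congruenceGL 3 γ).comap (unitaryGroupOfForm σ J).subtype : Subgroup ↥(unitaryGroupOfForm σ J)) : Set ↥(unitaryGroupOfForm σ J)) := by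
  classical
  have h2 : valuation K (⅟(2 : K)) ≠ 0 := by
    rw [Valuation.ne_zero_iff]; exact (invertibleInvOf (α := K) (a := 2)).ne_zero
  have hρ0 : ρ ≠ 0 := (lt_of_le_of_lt zero_le hγρ).ne'
  have hγ1 : γ < 1 := lt_of_lt_of_le hγρ hρ1
  have hγR : γ ≤ R * γ := by
    calc γ = 1 * γ := (one_mul γ).symm
      _ ≤ R * γ := mul_le_mul_left hR1 γ
  have h2γ : valuation K (⅟(2 : K)) * γ ≤ 1 := (mul_le_mul_right hγR _).trans h2R
  have hργ0 : ρ * γ ≠ 0 := mul_ne_zero hρ0 hγ0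
  have hRγρ : R * γ ≤ ρ := by
    calc R * γ = 1 * (R * γ) := (one_mul _).symm
      _ ≤ R * (R * γ) := mul_le_mul_left hR1 _
      _ = R * R * γ := (mul_assoc R R γ).symm
      _ ≤ ρ := hRR
  have hε : γ * (R * γ) ≤ ρ * γ := by
    calc γ * (R * γ) = R * γ * γ := by ac_rfl
      _ ≤ ρ * γ := mul_le_mul_left hRγρ γ
  have hab' : R * γ * (R * γ) ≤ ρ * γ := by
    calc R * γ * (R * γ) = R * R * γ * γ := by ac_rfl
      _ ≤ ρ * γ := mul_le_mul_left hRR γ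
  have hεγ : ρ * γ ≤ γ := by
    calc ρ * γ ≤ 1 * γ := mul_le_mul_left hρ1 γ
      _ = γ := one_mul γ
  have hεRγ : ρ * γ ≤ R * γ := hεγ.trans hγR
  have hwin : ∀ {X : ValueGroupWithZero K}, ρ ≤ X → X ≤ R → X * γ ≤ R * γ ∧ ρ * γ ≤ X * γ :=
    fun hlo hhi => ⟨mul_le_mul_left hhi γ, mul_le_mul_left hlo γ⟩
  -- depth at radius `γ` (★ (J4c)∕(J4b) `hρ`, `hρw`)
  have hdepthγ : valuation K (⅟(2 : K)) * valuation K ((((d 0)⁻¹ * d 1 : Kˣ) : K) - σ (((d 0)⁻¹ * d 1 : Kˣ) : K)) * (γ * γ) ≤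
      valuation K ((((d 0)⁻¹ * d 2 : Kˣ) : K) - 1) * γ := by
    rw [hB]
    calc valuation K (⅟(2 : K)) * valuation K ((((d 0)⁻¹ * d 1 : Kˣ) : K) - σ (((d 0)⁻¹ * d 1 : Kˣ) : K)) * (γ * γ)
        ≤ valuation K (⅟(2 : K)) * C * (γ * γ) := mul_le_mul_left (mul_le_mul_right hC _) _
      _ = valuation K (⅟(2 : K)) * C * γ * γ := (mul_assoc _ γ γ).symm
      _ ≤ B * γ := mul_le_mul_left hdepth γ
  have hdepthγ' : valuation K (⅟(2 : K)) * valuation K ((((d 2)⁻¹ * d 1 : Kˣ) : K) - σ (((d 2)⁻¹ * d 1 : Kˣ) : K)) * (γ * γ) ≤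
      valuation K ((((d 2)⁻¹ * d 0 : Kˣ) : K) - 1) * γ := by
    rw [hB']
    calc valuation K (⅟(2 : K)) * valuation K ((((d 2)⁻¹ * d 1 : Kˣ) : K) - σ (((d 2)⁻¹ * d 1 : Kˣ) : K)) * (γ * γ)
        ≤ valuation K (⅟(2 : K)) * C' * (γ * γ) := mul_le_mul_left (mul_le_mul_right hC' _) _
      _ = valuation K (⅟(2 : K)) * C' * γ * γ := (mul_assoc _ γ γ).symm
      _ ≤ B' * γ := mul_le_mul_left hdepth' γ
  have hCA₁ : valuation K (⅟(2 : K)) * valuation K ((((d 0)⁻¹ * d 1 : Kˣ) : K) - σ (((d 0)⁻¹ * d 1 : Kˣ) : K)) * (ρ * γ) ≤ A * A :=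
    (mul_le_mul_left (mul_le_mul_right hC _) _).trans hCA
  have hCA₁' : valuation K (⅟(2 : K)) * valuation K ((((d 2)⁻¹ * d 1 : Kˣ) : K) - σ (((d 2)⁻¹ * d 1 : Kˣ) : K)) * (ρ * γ) ≤ A' * A' :=
    (mul_le_mul_left (mul_le_mul_right hC' _) _).trans hCA'
  obtain ⟨θ, δ, μ, ρx, ρy, ρx', ρy', hθ0, hθ1, hθ, hδ0, hrec, hδ, hμ, hrad, hall, hbasis⟩ :=
    exists_levelSchedule_basis σ (J := J) (C := valuation K ((((d 0)⁻¹ * d 1 : Kˣ) : K) - σ (((d 0)⁻¹ * d 1 : Kˣ) : K)))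
      (C' := valuation K ((((d 2)⁻¹ * d 1 : Kˣ) : K) - σ (((d 2)⁻¹ * d 1 : Kˣ) : K)))
      hρ0 hρA hρB hρA' hρB' hρ1 hγ0 hγρ hργ0 (le_of_eq (mul_comm ρ γ)) h2γ hCA₁ hCA₁'
  have hboxγ : valuation K (⅟(2 : K)) * (valuation K ((((d 0)⁻¹ * d 1 : Kˣ) : K) - 1) * γ * (valuation K ((((d 0)⁻¹ * d 1 : Kˣ) : K) - 1) * γ)) ≤
      valuation K ((((d 0)⁻¹ * d 2 : Kˣ) : K) - 1) * γ := by
    rw [hA, hB]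
    calc valuation K (⅟(2 : K)) * (A * γ * (A * γ)) = valuation K (⅟(2 : K)) * (A * A) * γ * γ := by ac_rfl
      _ ≤ B * γ := mul_le_mul_left hbox γ
  have hboxγ' : valuation K (⅟(2 : K)) * (valuation K ((((d 2)⁻¹ * d 1 : Kˣ) : K) - 1) * γ * (valuation K ((((d 2)⁻¹ * d 1 : Kˣ) : K) - 1) * γ)) ≤
      valuation K ((((d 2)⁻¹ * d 0 : Kˣ) : K) - 1) * γ := by
    rw [hA', hB']
    calc valuation K (⅟(2 : K)) * (A' * γ * (A' * γ)) = valuation K (⅟(2 : K)) * (A' * A') * γ * γ := by ac_rfl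
      _ ≤ B' * γ := mul_le_mul_left hbox' γ
  obtain ⟨Bx, hBxN, hBx⟩ := exists_subgroup_coe_eq_image_box σ hσ hJ (valuation K) hσv
    (valuation K ((((d 0)⁻¹ * d 1 : Kˣ) : K) - 1) * γ) (valuation K ((((d 0)⁻¹ * d 2 : Kˣ) : K) - 1) * γ) hboxγ
  obtain ⟨B₂, hB₂N, hB₂⟩ := exists_subgroup_coe_eq_image_box σ hσ hJ (valuation K) hσv
    (valuation K ((((d 2)⁻¹ * d 1 : Kˣ) : K) - 1) * γ) (valuation K ((((d 2)⁻¹ * d 0 : Kˣ) : K) - 1) * γ) hboxγ'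
  obtain ⟨Bbar, hBbar_def⟩ : ∃ Bbar : Subgroup ↥(unitaryGroupOfForm σ J), Bbar = B₂.map (MulAut.conj (weylLongU σ hJ)).toMonoidHom := ⟨_, rfl⟩
  have hBbar : (Bbar : Set ↥(unitaryGroupOfForm σ J)) =
      (fun n : ↥(unipotentU σ J) => weylLongU σ hJ * (n : ↥(unitaryGroupOfForm σ J)) * (weylLongU σ hJ)⁻¹) ''
        {n | valuation K (heisX σ n) ≤ valuation K ((((d 2)⁻¹ * d 1 : Kˣ) : K) - 1) * γ ∧
          valuation K (heisY σ hσ hJ n : K) ≤ valuation K ((((d 2)⁻¹ * d 0 : Kˣ) : K) - 1) * γ} := by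
    rw [hBbar_def, Subgroup.coe_map, hB₂, Set.image_image]
    rfl
  have hBx_mem : ∀ n : ↥(unipotentU σ J), valuation K (heisX σ n) ≤ valuation K ((((d 0)⁻¹ * d 1 : Kˣ) : K) - 1) * γ →
      valuation K (heisY σ hσ hJ n : K) ≤ valuation K ((((d 0)⁻¹ * d 2 : Kˣ) : K) - 1) * γ → (n : ↥(unitaryGroupOfForm σ J)) ∈ Bx := by
    intro n hx hy
    rw [← SetLike.mem_coe, hBx]
    exact ⟨n, ⟨hx, hy⟩, rfl⟩
  have hBbar_mem : ∀ n : ↥(unipotentU σ J), valuation K (heisX σ n) ≤ valuation K ((((d 2)⁻¹ * d 1 : Kˣ) : K) - 1) * γ →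
      valuation K (heisY σ hσ hJ n : K) ≤ valuation K ((((d 2)⁻¹ * d 0 : Kˣ) : K) - 1) * γ →
        weylLongU σ hJ * (n : ↥(unitaryGroupOfForm σ J)) * (weylLongU σ hJ)⁻¹ ∈ Bbar := by
    intro n hx hy
    rw [← SetLike.mem_coe, hBbar]
    exact ⟨n, ⟨hx, hy⟩, rfl⟩
  have hBx_sub : ∀ g ∈ Bx, ∃ n : ↥(unipotentU σ J), (n : ↥(unitaryGroupOfForm σ J)) = g ∧
      valuation K (heisX σ n) ≤ valuation K ((((d 0)⁻¹ * d 1 : Kˣ) : K) - 1) * γ ∧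
        valuation K (heisY σ hσ hJ n : K) ≤ valuation K ((((d 0)⁻¹ * d 2 : Kˣ) : K) - 1) * γ := by
    intro g hg
    rw [← SetLike.mem_coe, hBx] at hg
    obtain ⟨n, ⟨hx, hy⟩, rfl⟩ := hg
    exact ⟨n, rfl, hx, hy⟩
  have hBbar_sub : ∀ g ∈ Bbar, ∃ m : ↥(unipotentU σ J), weylLongU σ hJ * (m : ↥(unitaryGroupOfForm σ J)) * (weylLongU σ hJ)⁻¹ = g ∧
      valuation K (heisX σ m) ≤ valuation K ((((d 2)⁻¹ * d 1 : Kˣ) : K) - 1) * γ ∧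
        valuation K (heisY σ hσ hJ m : K) ≤ valuation K ((((d 2)⁻¹ * d 0 : Kˣ) : K) - 1) * γ := by
    intro g hg
    rw [← SetLike.mem_coe, hBbar] at hg
    obtain ⟨m, ⟨hx, hy⟩, rfl⟩ := hg
    exact ⟨m, rfl, hx, hy⟩
  -- `B ≤ K_{Rγ}`, `B̄ ≤ K_{Rγ}` (§1 at level `Rγ`; `w₀` normalises the levels)
  have hL1 : ∀ (η : ValueGroupWithZero K) (n : ↥(unipotentU σ J)), valuation K (⅟(2 : K)) * η ≤ 1 →
      valuation K (heisX σ n) ≤ η → valuation K (heisY σ hσ hJ n : K) ≤ η →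
        (n : ↥(unitaryGroupOfForm σ J)) ∈ (congruenceGL 3 η).comap (unitaryGroupOfForm σ J).subtype :=
    fun η n h hx hy => mem_level_of_box σ hσ hJ hσv h n hx hy
  have hBxK : Bx ≤ (congruenceGL 3 (R * γ)).comap (unitaryGroupOfForm σ J).subtype := by
    intro g hg
    obtain ⟨n, rfl, hx, hy⟩ := hBx_sub g hg
    refine hL1 (R * γ) n h2R (hx.trans ?_) (hy.trans ?_)
    · rw [hA]; exact (hwin hρA hRA).1
    · rw [hB]; exact (hwin hρB hRB).1
  have hBbarK : Bbar ≤ (congruenceGL 3 (R * γ)).comap (unitaryGroupOfForm σ J).subtype := by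
    intro g hg
    obtain ⟨m, rfl, hx, hy⟩ := hBbar_sub g hg
    have hm : (m : ↥(unitaryGroupOfForm σ J)) ∈ (congruenceGL 3 (R * γ)).comap (unitaryGroupOfForm σ J).subtype := by
      refine hL1 (R * γ) m h2R (hx.trans ?_) (hy.trans ?_)
      · rw [hA']; exact (hwin hρA' hRA').1
      · rw [hB']; exact (hwin hρB' hRB').1
    have h := (map_conj_weylLongU_level_eq σ hJ (R * γ)).le (Subgroup.mem_map_of_mem (MulAut.conj (weylLongU σ hJ)).toMonoidHom hm)
    exact h
  have hEK : (congruenceGL 3 (ρ * γ)).comap (unitaryGroupOfForm σ J).subtype ≤ (congruenceGL 3 (R * γ)).comap (unitaryGroupOfForm σ J).subtype :=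
    Subgroup.comap_mono (congruenceGL_mono hεRγ)
  have hab : ∀ x ∈ (congruenceGL 3 (R * γ)).comap (unitaryGroupOfForm σ J).subtype, ∀ y ∈ (congruenceGL 3 (R * γ)).comap (unitaryGroupOfForm σ J).subtype,
      x * y * x⁻¹ * y⁻¹ ∈ (congruenceGL 3 (ρ * γ)).comap (unitaryGroupOfForm σ J).subtype :=
    fun x hx y hy => commutator_mem_comap_congruenceGL_of_mul_le (unitaryGroupOfForm σ J).subtype hab' hx hy
  refine ⟨Bbar ⊔ ((((congruenceGL 3 γ).comap (unitaryGroupOfForm σ J).subtype) ⊓ torusU σ J) ⊔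
      (Bx ⊔ (congruenceGL 3 (ρ * γ)).comap (unitaryGroupOfForm σ J).subtype)), ?_, ?_, ?_⟩
  · -- open: contains the open subgroup `K_{ργ}`
    apply Subgroup.isOpen_mono (H₁ := (congruenceGL 3 (ρ * γ)).comap (unitaryGroupOfForm σ J).subtype)
    · exact le_sup_right.trans (le_sup_right.trans le_sup_right)
    · exact (isCompact_isOpen_comap_congruenceGL σ (J := J) hσc hργ0).2
  · exact setOf_conj_eq_smul_sandwich σ hσ hJ hσc hσv s hreg hd hγ0 hγ1 hγR hε h2γ hdepthγ hdepthγ'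
      δ μ ρx ρy ρx' ρy' hδ0 hrec (fun n => (hall n).2.2.2.2.2.2.2.2.2.2.2.2.2.1) (fun n => (hall n).2.2.2.2.2.2.2.2.2.2.2.2.2.2.2.1)
      (fun n => ((hall n).2.2.2.2.2.2.2.2.2.2.2.2.1).trans hεγ) (fun n => (hall n).2.2.2.2.2.2.2.2.2.2.2.1)
      (fun n => (hall n).2.2.2.2.2.2.1) (fun n => (hall n).2.2.2.2.2.2.2.1) (fun n => (hall n).2.2.2.2.2.2.2.2.1) (fun n => (hall n).2.2.2.2.2.2.2.2.2.1)
      (fun n => by rw [hA]; exact (hall n).2.2.1) (fun n => by rw [hB]; exact (hall n).2.2.2.1)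
      (fun n => by rw [hA']; exact (hall n).2.2.2.2.1) (fun n => by rw [hB']; exact (hall n).2.2.2.2.2.1)
      (fun n => by rw [hB]; exact (hall n).2.2.2.2.2.2.2.2.2.2.2.2.2.2.2.2.1)
      (fun n => by rw [hB']; exact (hall n).2.2.2.2.2.2.2.2.2.2.2.2.2.2.2.2.2)
      (fun n => (hall n).2.2.2.2.2.2.2.2.2.2.1) (fun n => (hall n).2.2.2.2.2.2.2.2.2.2.2.2.2.2.1) hbasis
      hL1 Bx Bbar hBxK hBx_mem hBbar_mem hBx_sub hBbar_sub hEK hab hBbarK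
  · intro ν hν
    haveI := hν
    exact measure_sandwich_eq_vanDijk_mul_measure_level σ hσ hσc hJ hσv ν μN s sw hd hdw hreg hregw hργ0 hεγ hγR hRγ hab' h2R
      (by rw [hA]; exact (hwin hρA hRA).1) (by rw [hB]; exact (hwin hρB hRB).1)
      (by rw [hA']; exact (hwin hρA' hRA').1) (by rw [hB']; exact (hwin hρB' hRB').1)
      (by rw [hA]; exact (hwin hρA hRA).2) (by rw [hB]; exact (hwin hρB hRB).2)
      (by rw [hA']; exact (hwin hρA' hRA').2) (by rw [hB']; exact (hwin hρB' hRB').2)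
      hdepthγ hdepthγ' Bx Bbar hBx hBbar

end Package

/-! ## §3 A level bound from the sizes alone -/

section Arith

variable {Γ₀ : Type*} [LinearOrderedCommGroupWithZero Γ₀]

/-- `X ≠ 0`, `γ ≤ T·X⁻¹` ⇒ `X·γ ≤ T`. [cite: HarishChandra1970, Lemma 22] -/
theorem mul_le_of_le_mul_inv {X T γ : Γ₀} (hX : X ≠ 0) (h : γ ≤ T * X⁻¹) : X * γ ≤ T := by
  calc X * γ ≤ X * (T * X⁻¹) := mul_le_mul_right h X
    _ = T := by rw [mul_comm T, ← mul_assoc, mul_inv_cancel₀ hX, one_mul]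

/-- `X ≠ 0`, `T ≠ 0`, `q < 1`, `γ ≤ T·X⁻¹·q` ⇒ `X·γ < T`. [cite: HarishChandra1970, Lemma 22] -/
theorem mul_lt_of_le_mul_inv_mul {X T γ q : Γ₀} (hX : X ≠ 0) (hT : T ≠ 0) (hq1 : q < 1) (h : γ ≤ T * X⁻¹ * q) : X * γ < T := by
  have h1 : X * γ ≤ T * q := by
    calc X * γ ≤ X * (T * X⁻¹ * q) := mul_le_mul_right h X
      _ = T * q := by rw [mul_comm T, mul_assoc, ← mul_assoc X, mul_inv_cancel₀ hX, one_mul, mul_comm]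
  calc X * γ ≤ T * q := h1
    _ = q * T := mul_comm T q
    _ < 1 * T := mul_lt_mul_of_pos_right hq1 (zero_lt_iff.2 hT)
    _ = T := one_mul T

/-- **A LEVEL BOUND FROM THE SIZES ALONE.**  For nonzero sizes `A B A′ B′`, arbitrary `C C′`, `h2 ≠ 0` (`= v(½)`) and any `0 ≠ q < 1` there are `ρ ≤ A, B, A′, B′, 1 ≤ R` and
`γ₀ ≠ 0` such that EVERY `0 ≠ γ ≤ γ₀` satisfies the ten inequalities of §2 `orbit_and_mass_of_small_level` — pure value-group arithmetic, so one `γ₀` serves every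
torus element with these sizes (★ SHIFT-LC ∕ (J6-D): the sizes are locally constant). [cite: HarishChandra1970, Lemma 22] [cite: vanDijk1972, §2] -/
theorem exists_small_level_bound (A B A' B' C C' h2 q : Γ₀) (hA0 : A ≠ 0) (hB0 : B ≠ 0) (hA'0 : A' ≠ 0) (hB'0 : B' ≠ 0)
    (h20 : h2 ≠ 0) (hq0 : q ≠ 0) (hq1 : q < 1) :
    ∃ ρ R γ₀ : Γ₀, ρ ≠ 0 ∧ ρ ≤ A ∧ ρ ≤ B ∧ ρ ≤ A' ∧ ρ ≤ B' ∧ ρ ≤ 1 ∧ A ≤ R ∧ B ≤ R ∧ A' ≤ R ∧ B' ≤ R ∧ 1 ≤ R ∧ γ₀ ≠ 0 ∧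
      ∀ γ : Γ₀, γ ≠ 0 → γ ≤ γ₀ →
        γ < ρ ∧ R * γ < 1 ∧ h2 * (R * γ) ≤ 1 ∧ R * R * γ ≤ ρ ∧ h2 * C * γ ≤ B ∧ h2 * C' * γ ≤ B' ∧
        h2 * C * (ρ * γ) ≤ A * A ∧ h2 * C' * (ρ * γ) ≤ A' * A' ∧ h2 * (A * A) * γ ≤ B ∧ h2 * (A' * A') * γ ≤ B' := by
  obtain ⟨ρ, hρ_def⟩ : ∃ ρ : Γ₀, ρ = min (min (min (min A B) A') B') 1 := ⟨_, rfl⟩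
  obtain ⟨R, hR_def⟩ : ∃ R : Γ₀, R = max (max (max (max A B) A') B') 1 := ⟨_, rfl⟩
  have hρA : ρ ≤ A := by rw [hρ_def]; exact (min_le_left _ _).trans ((min_le_left _ _).trans ((min_le_left _ _).trans (min_le_left _ _)))
  have hρB : ρ ≤ B := by rw [hρ_def]; exact (min_le_left _ _).trans ((min_le_left _ _).trans ((min_le_left _ _).trans (min_le_right _ _)))
  have hρA' : ρ ≤ A' := by rw [hρ_def]; exact (min_le_left _ _).trans ((min_le_left _ _).trans (min_le_right _ _))
  have hρB' : ρ ≤ B' := by rw [hρ_def]; exact (min_le_left _ _).trans (min_le_right _ _)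
  have hρ1 : ρ ≤ 1 := by rw [hρ_def]; exact min_le_right _ _
  have hRA : A ≤ R := by rw [hR_def]; exact le_trans (le_trans (le_trans (le_max_left _ _) (le_max_left _ _)) (le_max_left _ _)) (le_max_left _ _)
  have hRB : B ≤ R := by rw [hR_def]; exact le_trans (le_trans (le_trans (le_max_right _ _) (le_max_left _ _)) (le_max_left _ _)) (le_max_left _ _)
  have hRA' : A' ≤ R := by rw [hR_def]; exact le_trans (le_trans (le_max_right _ _) (le_max_left _ _)) (le_max_left _ _)
  have hRB' : B' ≤ R := by rw [hR_def]; exact le_trans (le_max_right _ _) (le_max_left _ _)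
  have hR1 : 1 ≤ R := by rw [hR_def]; exact le_max_right _ _
  have hρ0 : ρ ≠ 0 := by
    rw [hρ_def]
    refine (lt_min (lt_min (lt_min (lt_min ?_ ?_) ?_) ?_) zero_lt_one).ne' <;> exact zero_lt_iff.2 ‹_›
  have hR0 : R ≠ 0 := (lt_of_lt_of_le zero_lt_one hR1).ne'
  have hC1 : max C 1 ≠ 0 := (lt_of_lt_of_le zero_lt_one (le_max_right C 1)).ne'
  have hC1' : max C' 1 ≠ 0 := (lt_of_lt_of_le zero_lt_one (le_max_right C' 1)).ne'
  refine ⟨ρ, R, min (ρ * q) (min (R⁻¹ * q) (min ((h2 * R)⁻¹) (min (ρ * (R * R)⁻¹) (min (B * (h2 * max C 1)⁻¹) (min (B' * (h2 * max C' 1)⁻¹) (min (A * A * (h2 * max C 1 * ρ)⁻¹) (min (A' * A' * (h2 * max C' 1 * ρ)⁻¹) (min (B * (h2 * (A * A))⁻¹) (B' * (h2 * (A' * A'))⁻¹))))))))), hρ0, hρA, hρB, hρA', hρB', hρ1, hRA, hRB, hRA', hRB', hR1, ?_, ?_⟩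
  · -- `γ₀ ≠ 0`
    refine (lt_min (zero_lt_iff.2 (mul_ne_zero hρ0 hq0)) (lt_min (zero_lt_iff.2 (mul_ne_zero (inv_ne_zero hR0) hq0))
      (lt_min (zero_lt_iff.2 (inv_ne_zero (mul_ne_zero h20 hR0))) (lt_min (zero_lt_iff.2 (mul_ne_zero hρ0 (inv_ne_zero (mul_ne_zero hR0 hR0))))
      (lt_min (zero_lt_iff.2 (mul_ne_zero hB0 (inv_ne_zero (mul_ne_zero h20 hC1)))) (lt_min (zero_lt_iff.2 (mul_ne_zero hB'0 (inv_ne_zero (mul_ne_zero h20 hC1'))))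
      (lt_min (zero_lt_iff.2 (mul_ne_zero (mul_ne_zero hA0 hA0) (inv_ne_zero (mul_ne_zero (mul_ne_zero h20 hC1) hρ0))))
      (lt_min (zero_lt_iff.2 (mul_ne_zero (mul_ne_zero hA'0 hA'0) (inv_ne_zero (mul_ne_zero (mul_ne_zero h20 hC1') hρ0))))
      (lt_min (zero_lt_iff.2 (mul_ne_zero hB0 (inv_ne_zero (mul_ne_zero h20 (mul_ne_zero hA0 hA0)))))
      (zero_lt_iff.2 (mul_ne_zero hB'0 (inv_ne_zero (mul_ne_zero h20 (mul_ne_zero hA'0 hA'0)))))))))))))).ne'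
  · intro γ hγ0 hγ
    have hb1 : γ ≤ ρ * q := hγ.trans (min_le_left _ _)
    have hb2 : γ ≤ R⁻¹ * q := hγ.trans ((min_le_right _ _).trans (min_le_left _ _))
    have hb3 : γ ≤ (h2 * R)⁻¹ := hγ.trans ((min_le_right _ _).trans ((min_le_right _ _).trans (min_le_left _ _)))
    have hb4 : γ ≤ ρ * (R * R)⁻¹ := hγ.trans ((min_le_right _ _).trans ((min_le_right _ _).trans ((min_le_right _ _).trans (min_le_left _ _))))
    have hb5 : γ ≤ B * (h2 * max C 1)⁻¹ := hγ.trans ((min_le_right _ _).trans ((min_le_right _ _).trans ((min_le_right _ _).trans ((min_le_right _ _).trans (min_le_left _ _)))))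
    have hb6 : γ ≤ B' * (h2 * max C' 1)⁻¹ := hγ.trans ((min_le_right _ _).trans ((min_le_right _ _).trans ((min_le_right _ _).trans ((min_le_right _ _).trans ((min_le_right _ _).trans (min_le_left _ _))))))
    have hb7 : γ ≤ A * A * (h2 * max C 1 * ρ)⁻¹ := hγ.trans ((min_le_right _ _).trans ((min_le_right _ _).trans ((min_le_right _ _).trans ((min_le_right _ _).trans ((min_le_right _ _).trans ((min_le_right _ _).trans (min_le_left _ _)))))))
    have hb8 : γ ≤ A' * A' * (h2 * max C' 1 * ρ)⁻¹ := hγ.trans ((min_le_right _ _).trans ((min_le_right _ _).trans ((min_le_right _ _).trans ((min_le_right _ _).trans ((min_le_right _ _).trans ((min_le_right _ _).trans ((min_le_right _ _).trans (min_le_left _ _))))))))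
    have hb9 : γ ≤ B * (h2 * (A * A))⁻¹ := hγ.trans ((min_le_right _ _).trans ((min_le_right _ _).trans ((min_le_right _ _).trans ((min_le_right _ _).trans ((min_le_right _ _).trans ((min_le_right _ _).trans ((min_le_right _ _).trans ((min_le_right _ _).trans (min_le_left _ _)))))))))
    have hb10 : γ ≤ B' * (h2 * (A' * A'))⁻¹ := hγ.trans ((min_le_right _ _).trans ((min_le_right _ _).trans ((min_le_right _ _).trans ((min_le_right _ _).trans ((min_le_right _ _).trans ((min_le_right _ _).trans ((min_le_right _ _).trans ((min_le_right _ _).trans ((min_le_right _ _).trans (le_rfl))))))))))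
    have hCle : h2 * C ≤ h2 * max C 1 := mul_le_mul_right (le_max_left C 1) h2
    have hCle' : h2 * C' ≤ h2 * max C' 1 := mul_le_mul_right (le_max_left C' 1) h2
    refine ⟨?_, ?_, ?_, ?_, ?_, ?_, ?_, ?_, ?_, ?_⟩
    · -- `γ < ρ`
      calc γ ≤ ρ * q := hb1
        _ = q * ρ := mul_comm ρ q
        _ < 1 * ρ := mul_lt_mul_of_pos_right hq1 (zero_lt_iff.2 hρ0)
        _ = ρ := one_mul ρ
    · -- `R γ < 1`
      exact mul_lt_of_le_mul_inv_mul hR0 one_ne_zero hq1 (by rwa [one_mul])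
    · -- `h2 (R γ) ≤ 1`
      rw [← mul_assoc]
      exact mul_le_of_le_mul_inv (mul_ne_zero h20 hR0) (by rwa [one_mul])
    · -- `R R γ ≤ ρ`
      exact mul_le_of_le_mul_inv (mul_ne_zero hR0 hR0) hb4
    · -- `h2 C γ ≤ B`
      exact (mul_le_mul_left hCle γ).trans (mul_le_of_le_mul_inv (mul_ne_zero h20 hC1) hb5)
    · exact (mul_le_mul_left hCle' γ).trans (mul_le_of_le_mul_inv (mul_ne_zero h20 hC1') hb6)
    · -- `h2 C (ρ γ) ≤ A A`
      have h : h2 * max C 1 * (ρ * γ) ≤ A * A := by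
        rw [← mul_assoc]
        exact mul_le_of_le_mul_inv (mul_ne_zero (mul_ne_zero h20 hC1) hρ0) hb7
      exact (mul_le_mul_left hCle _).trans h
    · have h : h2 * max C' 1 * (ρ * γ) ≤ A' * A' := by
        rw [← mul_assoc]
        exact mul_le_of_le_mul_inv (mul_ne_zero (mul_ne_zero h20 hC1') hρ0) hb8
      exact (mul_le_mul_left hCle' _).trans h
    · exact mul_le_of_le_mul_inv (mul_ne_zero h20 (mul_ne_zero hA0 hA0)) hb9
    · exact mul_le_of_le_mul_inv (mul_ne_zero h20 (mul_ne_zero hA'0 hA'0)) hb10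

end Arith

end Summit.HodgeConjecture.HodgeConjecture.Cruxes.H413.F0P3cStCharTSLevelPackage

end
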